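import Literature.MathematicalPhysics.QuantumFieldTheory.TphiSeminormExpectation
import Literature.Probability.Distributions.GaussianQuadraticTilt
import HarnessLib

/-!
# Gaussian convolution in the regulated `T_φ`-seminorm: exact regulator renormalisation

The large-field ("regulator") form of Bauerschmidt–Brydges–Slade's Proposition 7.3.1. Measure a
smooth functional `F` of the field `φ ∈ ℝ^ι` (Euclidean space) by the `T_φ(𝔥)`-seminorm
(`TphiSeminorm.lean`) *weighted by a Gaussian regulator* `G_M(φ) = e^{½ φᵀMφ}`, `M ⪰ 0`:

  `‖F‖_{T,G_M} = sup_φ ‖F‖_{T_φ(𝔥)} / G_M(φ)`  (here as the predicate `‖F‖_{T_φ(𝔥)} ≤ A·G_M(φ)` for all `φ`).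

Integrating out a centred Gaussian fluctuation field `ζ ∼ N(0,S)` (`S ⪰ 0`, possibly singular — a
piece of a finite-range decomposition) gives the convolution `(𝔼θF)(φ) = ∫ F(φ + ζ) N(0,S)(dζ)`, and

  `‖𝔼θF‖_{T_φ(𝔥)} ≤ A · e^{½ φᵀ M(1−SM)⁻¹ φ} / √det(1 − SM)`      (`tphiSeminorm_gaussian_convolution_le`)

for every `φ`, provided the regulator is STRICTLY subcritical for `S` with a margin `t > 1`:
`1 − √S (tM) √S ≻ 0`. That is, `‖𝔼θF‖_{T,G_{M₊}} ≤ det(1−SM)^{−1/2} ‖F‖_{T,G_M}` with the *exactly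
renormalised* regulator `M₊ = M(1 − SM)⁻¹` — the regulator flow whose matrix algebra (tower
factorisation, `∏ det = det(1 − CM)`) is `Literature/Analysis/Matrix/RegulatorRenormalisation.lean`.

Ingredients: BBS (7.3.3) `‖𝔼θF‖_{T_φ} ≤ 𝔼‖F‖_{T_{φ+ζ}}` (`tphiSeminorm_integral_comp_add_le`, which
needs local domination of the `φ`-derivatives — supplied here from the regulator bound and the margin
`t > 1` via the Young-type inequality `(x+ζ)ᵀM(x+ζ) ≤ t ζᵀMζ + (t/(t−1)) xᵀMx`,
`derivDominated_shift_gaussian_of_tphiSeminorm_le`), and the closed form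
`∫ e^{½(x+φ)ᵀM(x+φ)} N(0,S)(dx) = e^{½ φᵀM(1−SM)⁻¹φ}/√det(1 − SM)`
(`Literature.Probability.Distributions.norm_integral_shift_le_of_norm_le_exp`).

Context: the norm of the fluctuation step `K ↦ 𝔼_{C_j} θ K` with the `(1−ε₀)`-critical regulator
`G_j = e^{(1−ε₀)(K/2)(φ,M_jφ)}` of line `fat-gaussian-defect-calculus` (crux
`BalabanIR.BirComplexStableXYR`, Hubbard summit), D1′(c)/T-RG.

## References

* R. Bauerschmidt, D. C. Brydges, G. Slade, *Introduction to a Renormalisation Group Method*,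
  LNM 2242 (2019), Proposition 7.3.1. [BauerschmidtBrydgesSlade2019RG]
* D. C. Brydges, G. Slade, *A renormalisation group method. I. Gaussian integration and normed
  algebras*, J. Stat. Phys. 159 (2015) 421–460 (regulators and the `Φ`/`T_φ` norms). [BrydgesSlade2015I]
-/

noncomputable section

namespace Literature.MathematicalPhysics.QuantumFieldTheory

open MeasureTheory ProbabilityTheory Matrix WithLp Set Metric Finset
open scoped MatrixOrder
open Literature.Probability.Distributions
open Literature.MathematicalPhysics.QuantumFieldTheory.GaussianToolkit

variable {ι : Type*} [Fintype ι] [DecidableEq ι]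
variable {A : Type*} [NormedRing A] [NormedAlgebra ℝ A]

/-! ### A Young inequality for positive semidefinite quadratic forms -/

omit [DecidableEq ι] in
/-- Expansion of a symmetric quadratic form: `(u+v)ᵀM(u+v) = uᵀMu + vᵀMv + 2 uᵀMv` for `Mᵀ = M`.
[folklore] -/
theorem dotProduct_mulVec_add_add {M : Matrix ι ι ℝ} (hM : Mᵀ = M) (u v : ι → ℝ) :
    (u + v) ⬝ᵥ M *ᵥ (u + v) = u ⬝ᵥ M *ᵥ u + v ⬝ᵥ M *ᵥ v + 2 * (u ⬝ᵥ M *ᵥ v) := by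
  have hsymm : v ⬝ᵥ M *ᵥ u = u ⬝ᵥ M *ᵥ v := by
    rw [dotProduct_mulVec, ← mulVec_transpose, hM, dotProduct_comm]
  rw [mulVec_add, add_dotProduct, dotProduct_add, dotProduct_add, hsymm]
  ring

omit [DecidableEq ι] in
/-- Expansion with a difference: `(u−v)ᵀM(u−v) = uᵀMu + vᵀMv − 2 uᵀMv` for `Mᵀ = M`. [folklore] -/
theorem dotProduct_mulVec_sub_sub {M : Matrix ι ι ℝ} (hM : Mᵀ = M) (u v : ι → ℝ) :
    (u - v) ⬝ᵥ M *ᵥ (u - v) = u ⬝ᵥ M *ᵥ u + v ⬝ᵥ M *ᵥ v - 2 * (u ⬝ᵥ M *ᵥ v) := by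
  have h := dotProduct_mulVec_add_add hM u (-v)
  simp only [mulVec_neg, dotProduct_neg, neg_dotProduct, neg_neg] at h
  rw [sub_eq_add_neg, h]
  ring

omit [DecidableEq ι] in
/-- **Young's inequality for a positive semidefinite quadratic form**: for `M ⪰ 0`, `t > 1` and all
`x, ζ`, `(x+ζ)ᵀM(x+ζ) ≤ t · ζᵀMζ + (t/(t−1)) · xᵀMx`. [folklore] -/
theorem dotProduct_mulVec_add_le_of_posSemidef {M : Matrix ι ι ℝ} (hM : M.PosSemidef) {t : ℝ} (ht : 1 < t)
    (x ζ : ι → ℝ) :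
    (x + ζ) ⬝ᵥ M *ᵥ (x + ζ) ≤ t * (ζ ⬝ᵥ M *ᵥ ζ) + t / (t - 1) * (x ⬝ᵥ M *ᵥ x) := by
  have hMT : Mᵀ = M := by
    have h := hM.1
    rw [IsHermitian, conjTranspose_eq_transpose_of_trivial] at h
    exact h
  have ht1 : 0 < t - 1 := sub_pos.2 ht
  -- `0 ≤ q((t−1)ζ − x) = (t−1)² q(ζ) + q(x) − 2(t−1) B`
  have hpsd : 0 ≤ ((t - 1) • ζ - x) ⬝ᵥ M *ᵥ ((t - 1) • ζ - x) := by
    have h := hM.dotProduct_mulVec_nonneg ((t - 1) • ζ - x)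
    rwa [star_trivial] at h
  rw [dotProduct_mulVec_sub_sub hMT] at hpsd
  simp only [mulVec_smul, dotProduct_smul, smul_dotProduct, smul_eq_mul] at hpsd
  rw [dotProduct_mulVec_add_add hMT]
  have hxz : ζ ⬝ᵥ M *ᵥ x = x ⬝ᵥ M *ᵥ ζ := by
    rw [dotProduct_mulVec, ← mulVec_transpose, hMT, dotProduct_comm]
  rw [hxz] at hpsd
  have hq0 : 0 ≤ x ⬝ᵥ M *ᵥ x := by
    have h := hM.dotProduct_mulVec_nonneg x
    rwa [star_trivial] at h
  -- divide by `t − 1 > 0`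
  have key : 2 * (x ⬝ᵥ M *ᵥ ζ) ≤ (t - 1) * (ζ ⬝ᵥ M *ᵥ ζ) + (x ⬝ᵥ M *ᵥ x) / (t - 1) := by
    rw [← sub_nonneg]
    have : (t - 1) * (ζ ⬝ᵥ M *ᵥ ζ) + x ⬝ᵥ M *ᵥ x / (t - 1) - 2 * (x ⬝ᵥ M *ᵥ ζ) =
        ((t - 1) * ((t - 1) * (ζ ⬝ᵥ M *ᵥ ζ)) + x ⬝ᵥ M *ᵥ x - 2 * ((t - 1) * (x ⬝ᵥ M *ᵥ ζ))) / (t - 1) := by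
      field_simp
    rw [this]
    exact div_nonneg hpsd ht1.le
  rw [show t * (ζ ⬝ᵥ M *ᵥ ζ) + t / (t - 1) * (x ⬝ᵥ M *ᵥ x) =
      (x ⬝ᵥ M *ᵥ x + ζ ⬝ᵥ M *ᵥ ζ) + ((t - 1) * (ζ ⬝ᵥ M *ᵥ ζ) + (x ⬝ᵥ M *ᵥ x) / (t - 1)) by
    field_simp; ring]
  linarith [key]

/-! ### Local domination of the derivatives from a regulator bound -/

omit [DecidableEq ι] in
/-- The quadratic form `x ↦ xᵀMx` is bounded on bounded sets of Euclidean space: a bound on the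
unit ball around `x₀`. [folklore] -/
theorem exists_bound_dotProduct_mulVec_ball (M : Matrix ι ι ℝ) (x₀ : EuclideanSpace ℝ ι) :
    ∃ C : ℝ, ∀ x ∈ ball x₀ 1, ofLp x ⬝ᵥ M *ᵥ ofLp x ≤ C := by
  have hc : Continuous fun x : EuclideanSpace ℝ ι => ofLp x ⬝ᵥ M *ᵥ ofLp x :=
    (PiLp.continuous_ofLp 2 _).dotProduct (continuous_const.matrix_mulVec (PiLp.continuous_ofLp 2 _))
  obtain ⟨C, hC⟩ := (isCompact_closedBall x₀ 1).exists_bound_of_continuousOn hc.continuousOn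
  refine ⟨C, fun x hx => ?_⟩
  have h := hC x (ball_subset_closedBall hx)
  rw [Real.norm_eq_abs] at h
  exact (le_abs_self _).trans h

omit [DecidableEq ι] in
/-- A single Taylor coefficient is dominated by the seminorm: `(𝔥^p/p!)‖D^pF(φ)‖ ≤ ‖F‖_{T_φ(𝔥)}`,
`p ≤ N`. [folklore] -/
theorem pow_div_factorial_mul_norm_le_tphiSeminorm {E : Type*} [NormedAddCommGroup E] [NormedSpace ℝ E]
    (N : ℕ) {𝔥 : ℝ} (h𝔥 : 0 ≤ 𝔥) (F : E → A) (φ : E) {p : ℕ} (hp : p ≤ N) :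
    𝔥 ^ p / (p.factorial : ℝ) * ‖iteratedFDeriv ℝ p F φ‖ ≤ tphiSeminorm N 𝔥 F φ := by
  unfold tphiSeminorm
  exact single_le_sum (f := fun q => 𝔥 ^ q / (q.factorial : ℝ) * ‖iteratedFDeriv ℝ q F φ‖)
    (fun q _ => by positivity) (mem_range.2 (Nat.lt_succ_of_le hp))

variable {S M : Matrix ι ι ℝ}

omit [Fintype ι] [DecidableEq ι] in
/-- `(tM)ᵀ = tM` for symmetric `M`. [folklore] -/
theorem transpose_smul_of_transpose_eq (hM : Mᵀ = M) (t : ℝ) : (t • M)ᵀ = t • M := by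
  rw [transpose_smul, hM]

/-- From the margin: `1 − √S(tM)√S ≻ 0` with `t ≥ 1`, `M ⪰ 0` implies `1 − √S M √S ≻ 0`. [folklore] -/
theorem posDef_one_sub_sqrt_mul_sqrt_of_margin (hM : M.PosSemidef) {t : ℝ} (ht : 1 ≤ t)
    (hsub : (1 - CFC.sqrt S * (t • M) * CFC.sqrt S).PosDef) :
    (1 - CFC.sqrt S * M * CFC.sqrt S).PosDef := by
  set T := CFC.sqrt S with hTdef
  have hT : Tᵀ = T := transpose_sqrt (S := S)
  have hTMT : (T * M * T).PosSemidef := by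
    have h := hM.conjTranspose_mul_mul_same T
    rwa [conjTranspose_eq_transpose_of_trivial, hT] at h
  have hdec : 1 - T * M * T = (1 - T * (t • M) * T) + (t - 1) • (T * M * T) := by
    rw [Matrix.mul_smul, Matrix.smul_mul, sub_smul, one_smul]
    abel
  rw [hdec]
  exact hsub.add_posSemidef (hTMT.smul (sub_nonneg.2 ht))

/-- **Local domination of the derivatives from a regulator bound.** If `F : ℝ^ι → A` is `C^N` with
`‖F‖_{T_x(𝔥)} ≤ A e^{½ xᵀMx}` for all `x` (`𝔥 > 0`, `M ⪰ 0`), and the regulator has a margin `t > 1`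
of subcriticality for the covariance `S`, `1 − √S(tM)√S ≻ 0`, then the translated family
`(y, ζ) ↦ F(y + ζ)` has its `y`-derivatives of orders `≤ N` locally dominated by `N(0,S)`-integrable
functions of `ζ` (hypothesis `DerivDominated` of BBS (7.3.2)/(7.3.3)). [folklore] -/
theorem derivDominated_shift_gaussian_of_tphiSeminorm_le (N : ℕ) {𝔥 : ℝ} (h𝔥 : 0 < 𝔥)
    (hM : M.PosSemidef) {t : ℝ} (ht : 1 < t) (hsub : (1 - CFC.sqrt S * (t • M) * CFC.sqrt S).PosDef)
    {F : EuclideanSpace ℝ ι → A} (hF : ContDiff ℝ N F) {Areg : ℝ}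
    (hFA : ∀ x, tphiSeminorm N 𝔥 F x ≤ Areg * Real.exp ((ofLp x ⬝ᵥ M *ᵥ ofLp x) / 2)) :
    DerivDominated N (fun (y ζ : EuclideanSpace ℝ ι) => F (y + ζ)) (multivariateGaussian 0 S) := by
  have hMT : Mᵀ = M := by
    have h := hM.1
    rw [IsHermitian, conjTranspose_eq_transpose_of_trivial] at h
    exact h
  have hA0 : 0 ≤ Areg := by
    have h := (tphiSeminorm_nonneg N h𝔥.le F 0).trans (hFA 0)
    simp only [ofLp_zero, zero_dotProduct, zero_div, Real.exp_zero, mul_one] at h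
    exact h
  refine ⟨fun ζ => hF.comp (contDiff_id.add contDiff_const), fun p hp x => ?_, fun p hp x₀ => ?_⟩
  · -- measurability: `ζ ↦ D^pF(x + ζ)` is continuous
    have hcont : Continuous fun ζ : EuclideanSpace ℝ ι => iteratedFDeriv ℝ p F (x + ζ) :=
      (hF.continuous_iteratedFDeriv (by exact_mod_cast hp)).comp (continuous_const.add continuous_id)
    refine hcont.aestronglyMeasurable.congr (ae_of_all _ fun ζ => ?_)
    simp only
    rw [iteratedFDeriv_comp_add_right]
  · -- domination on the unit ball around `x₀`
    obtain ⟨C, hC⟩ := exists_bound_dotProduct_mulVec_ball M x₀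
    set K : ℝ := (p.factorial : ℝ) / 𝔥 ^ p * Areg * Real.exp (t / (t - 1) * C / 2) with hKdef
    have hint := integrable_exp_half_quadratic_shift_multivariateGaussian (S := S) (M := t • M)
      (transpose_smul_of_transpose_eq hMT t) hsub 0
    refine ⟨fun ζ => K * Real.exp (((ofLp ζ + 0) ⬝ᵥ (t • M) *ᵥ (ofLp ζ + 0)) / 2), hint.const_mul K,
      1, zero_lt_one, ae_of_all _ fun ζ x hx => ?_⟩
    rw [iteratedFDeriv_comp_add_right]
    -- `‖D^pF(x+ζ)‖ ≤ p!/𝔥^p ‖F‖_{T_{x+ζ}} ≤ p!/𝔥^p A e^{½ q(x+ζ)}`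
    have hcoef := pow_div_factorial_mul_norm_le_tphiSeminorm N h𝔥.le F (x + ζ) hp
    have hc : (0 : ℝ) < 𝔥 ^ p / (p.factorial : ℝ) := by positivity
    have h1 : ‖iteratedFDeriv ℝ p F (x + ζ)‖ ≤ (p.factorial : ℝ) / 𝔥 ^ p * tphiSeminorm N 𝔥 F (x + ζ) := by
      rw [show (p.factorial : ℝ) / 𝔥 ^ p = (𝔥 ^ p / (p.factorial : ℝ))⁻¹ by rw [inv_div],
        ← div_eq_inv_mul, le_div_iff₀ hc, mul_comm]
      exact hcoef
    have h2 := hFA (x + ζ)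
    -- Young: `q(x + ζ) ≤ t q(ζ) + (t/(t-1)) q(x) ≤ t q(ζ) + (t/(t-1)) C`
    have hq : ofLp (x + ζ) ⬝ᵥ M *ᵥ ofLp (x + ζ) ≤ t * (ofLp ζ ⬝ᵥ M *ᵥ ofLp ζ) + t / (t - 1) * C := by
      rw [WithLp.ofLp_add]
      refine (dotProduct_mulVec_add_le_of_posSemidef hM ht (ofLp x) (ofLp ζ)).trans ?_
      have htt : 0 ≤ t / (t - 1) := div_nonneg (by linarith) (by linarith)
      gcongr
      exact hC x hx
    have h3 : Real.exp ((ofLp (x + ζ) ⬝ᵥ M *ᵥ ofLp (x + ζ)) / 2) ≤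
        Real.exp (t / (t - 1) * C / 2) * Real.exp (((ofLp ζ + 0) ⬝ᵥ (t • M) *ᵥ (ofLp ζ + 0)) / 2) := by
      rw [← Real.exp_add, add_zero, smul_mulVec, dotProduct_smul, smul_eq_mul]
      exact Real.exp_le_exp.2 (by linarith)
    calc ‖iteratedFDeriv ℝ p F (x + ζ)‖
        ≤ (p.factorial : ℝ) / 𝔥 ^ p * tphiSeminorm N 𝔥 F (x + ζ) := h1
      _ ≤ (p.factorial : ℝ) / 𝔥 ^ p * (Areg * Real.exp ((ofLp (x + ζ) ⬝ᵥ M *ᵥ ofLp (x + ζ)) / 2)) := by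
          gcongr
      _ ≤ (p.factorial : ℝ) / 𝔥 ^ p * (Areg * (Real.exp (t / (t - 1) * C / 2) *
            Real.exp (((ofLp ζ + 0) ⬝ᵥ (t • M) *ᵥ (ofLp ζ + 0)) / 2))) := by
          gcongr
      _ = K * Real.exp (((ofLp ζ + 0) ⬝ᵥ (t • M) *ᵥ (ofLp ζ + 0)) / 2) := by
          rw [hKdef]; ring

/-! ### The convolution bound -/

variable [CompleteSpace A]

/-- **Gaussian convolution in the regulated `T_φ`-seminorm, with exact regulator renormalisation.**
Let `S ⪰ 0` (covariance of the fluctuation field `ζ ∼ N(0,S)`), `M ⪰ 0` a regulator with a margin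
`t > 1` of subcriticality, `1 − √S(tM)√S ≻ 0`, and `F : ℝ^ι → A` a `C^N` functional with
`‖F‖_{T_x(𝔥)} ≤ A e^{½ xᵀMx}` for all `x` (`𝔥 > 0`). Then for every `φ`,

  `‖∫ F(· + ζ) N(0,S)(dζ)‖_{T_φ(𝔥)} ≤ A · e^{½ φᵀ M(1−SM)⁻¹ φ} / √det(1 − SM)`,

i.e. `‖𝔼θF‖_{T,G_{M₊}} ≤ det(1−SM)^{−1/2} ‖F‖_{T,G_M}` with the renormalised regulator `M₊ = M(1−SM)⁻¹`.
[cite: BauerschmidtBrydgesSlade2019RG, Prop. 7.3.1] -/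
theorem tphiSeminorm_gaussian_convolution_le (N : ℕ) {𝔥 : ℝ} (h𝔥 : 0 < 𝔥) (hS : S.PosSemidef)
    (hM : M.PosSemidef) {t : ℝ} (ht : 1 < t) (hsub : (1 - CFC.sqrt S * (t • M) * CFC.sqrt S).PosDef)
    {F : EuclideanSpace ℝ ι → A} (hF : ContDiff ℝ N F) {Areg : ℝ}
    (hFA : ∀ x, tphiSeminorm N 𝔥 F x ≤ Areg * Real.exp ((ofLp x ⬝ᵥ M *ᵥ ofLp x) / 2))
    (φ : EuclideanSpace ℝ ι) :
    tphiSeminorm N 𝔥 (fun y => ∫ ζ, F (y + ζ) ∂(multivariateGaussian 0 S)) φ ≤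
      Areg * (Real.exp ((ofLp φ ⬝ᵥ (M * (1 - S * M)⁻¹) *ᵥ ofLp φ) / 2) / Real.sqrt (1 - S * M).det) := by
  have hMT : Mᵀ = M := by
    have h := hM.1
    rw [IsHermitian, conjTranspose_eq_transpose_of_trivial] at h
    exact h
  have hsub1 : (1 - CFC.sqrt S * M * CFC.sqrt S).PosDef := posDef_one_sub_sqrt_mul_sqrt_of_margin hM ht.le hsub
  have hD := derivDominated_shift_gaussian_of_tphiSeminorm_le N h𝔥 hM ht hsub hF hFA
  -- BBS (7.3.3)
  have h1 := tphiSeminorm_integral_comp_add_le N h𝔥.le hD φ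
  -- the regulated bound on the scalar function `x ↦ ‖F‖_{T_x}`
  set K : (ι → ℝ) → ℝ := fun v => tphiSeminorm N 𝔥 F (toLp 2 v) with hKdef
  have hK : ∀ v, ‖K v‖ ≤ Areg * Real.exp ((v ⬝ᵥ M *ᵥ v) / 2) := fun v => by
    rw [hKdef, Real.norm_eq_abs, abs_of_nonneg (tphiSeminorm_nonneg N h𝔥.le F _)]
    simpa using hFA (toLp 2 v)
  have h2 := norm_integral_shift_le_of_norm_le_exp (E := ℝ) hS hMT hsub1 hK (ofLp φ)
  have hfun : ∀ ζ : EuclideanSpace ℝ ι, tphiSeminorm N 𝔥 F (φ + ζ) = K (ofLp ζ + ofLp φ) := fun ζ => by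
    simp only [hKdef, ← WithLp.ofLp_add, toLp_ofLp, add_comm]
  calc tphiSeminorm N 𝔥 (fun y => ∫ ζ, F (y + ζ) ∂(multivariateGaussian 0 S)) φ
      ≤ ∫ ζ, tphiSeminorm N 𝔥 F (φ + ζ) ∂(multivariateGaussian 0 S) := h1
    _ = ∫ ζ, K (ofLp ζ + ofLp φ) ∂(multivariateGaussian 0 S) := integral_congr_ae (ae_of_all _ hfun)
    _ ≤ ‖∫ ζ, K (ofLp ζ + ofLp φ) ∂(multivariateGaussian 0 S)‖ := by
        rw [Real.norm_eq_abs]; exact le_abs_self _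
    _ ≤ Areg * (Real.exp ((ofLp φ ⬝ᵥ (M * (1 - S * M)⁻¹) *ᵥ ofLp φ) / 2) / Real.sqrt (1 - S * M).det) := h2

/-- **Zero external field**: `‖𝔼θF‖_{T_0(𝔥)} ≤ A / √det(1 − SM)`. [cite: BauerschmidtBrydgesSlade2019RG, Prop. 7.3.1] -/
theorem tphiSeminorm_gaussian_convolution_zero_le (N : ℕ) {𝔥 : ℝ} (h𝔥 : 0 < 𝔥) (hS : S.PosSemidef)
    (hM : M.PosSemidef) {t : ℝ} (ht : 1 < t) (hsub : (1 - CFC.sqrt S * (t • M) * CFC.sqrt S).PosDef)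
    {F : EuclideanSpace ℝ ι → A} (hF : ContDiff ℝ N F) {Areg : ℝ}
    (hFA : ∀ x, tphiSeminorm N 𝔥 F x ≤ Areg * Real.exp ((ofLp x ⬝ᵥ M *ᵥ ofLp x) / 2)) :
    tphiSeminorm N 𝔥 (fun y => ∫ ζ, F (y + ζ) ∂(multivariateGaussian 0 S)) 0 ≤
      Areg / Real.sqrt (1 - S * M).det := by
  have h := tphiSeminorm_gaussian_convolution_le N h𝔥 hS hM ht hsub hF hFA 0
  simpa [div_eq_mul_inv] using h

/-- **Precision-matrix form.** For `ζ ∼ N(0, P⁻¹)` with `P ≻ 0`, `M ⪰ 0` and the margin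
`P − tM ≻ 0` for some `t > 1`: `‖𝔼θF‖_{T_φ(𝔥)} ≤ A e^{½ φᵀM(1−P⁻¹M)⁻¹φ}/√det(1 − P⁻¹M)`.
[cite: BauerschmidtBrydgesSlade2019RG, Prop. 7.3.1] -/
theorem tphiSeminorm_gaussian_convolution_le_inv (N : ℕ) {𝔥 : ℝ} (h𝔥 : 0 < 𝔥) {P : Matrix ι ι ℝ}
    (hP : P.PosDef) (hM : M.PosSemidef) {t : ℝ} (ht : 1 < t) (hPM : (P - t • M).PosDef)
    {F : EuclideanSpace ℝ ι → A} (hF : ContDiff ℝ N F) {Areg : ℝ}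
    (hFA : ∀ x, tphiSeminorm N 𝔥 F x ≤ Areg * Real.exp ((ofLp x ⬝ᵥ M *ᵥ ofLp x) / 2))
    (φ : EuclideanSpace ℝ ι) :
    tphiSeminorm N 𝔥 (fun y => ∫ ζ, F (y + ζ) ∂(multivariateGaussian 0 P⁻¹)) φ ≤
      Areg * (Real.exp ((ofLp φ ⬝ᵥ (M * (1 - P⁻¹ * M)⁻¹) *ᵥ ofLp φ) / 2) / Real.sqrt (1 - P⁻¹ * M).det) := by
  have hPinv : P⁻¹⁻¹ = P :=
    Matrix.nonsing_inv_nonsing_inv P ((Matrix.isUnit_iff_isUnit_det _).1 hP.isUnit)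
  have hSM : (P⁻¹⁻¹ - t • M).PosDef := by rwa [hPinv]
  exact tphiSeminorm_gaussian_convolution_le N h𝔥 hP.inv.posSemidef hM ht
    (posDef_one_sub_sqrt_mul_sqrt hP.inv hSM) hF hFA φ

end Literature.MathematicalPhysics.QuantumFieldTheory

end
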